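import Summits.QuantumAdvantage.QuantumAdvantage.Theorems.OddPrimeWalkSignWalkCore

/-!
# OddPrimeWalk — sign-walk core II: growth bounds, the unit contraction, parity core, weight counts mod 3

Support machinery for item stmt-QuantumAdvantage-24332 `SignWalkFloorThree` (route OddPrimeWalk, planner qa-qnc0-p2
g32, PROOF-BB L2–L5; prover qn-prover-3 g20), continuing `OddPrimeWalkSignWalkCore`:

* BOUNDS: sup / `ℓ¹` growth `≤ 2^m` (`abs_evo_le`, `l1_evo_le`); squared-norm growth `≤ 4` per step (`nrm_step_le`) and
  the UNIT CONTRACTION `nrm_step_step_le`: a reflection factor `refl c = 2δ_c − 1` sandwiched between two steps costs a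
  factor `8` instead of `16` (`‖P·diag(2δ_c−1)·P‖² ≤ ½` in normalised form, three explicit sums of squares — the
  planner's `BBCore.pgp_sq_le_half`); chained over a set of pairwise non-adjacent reflection sites: `nrm_evo_le`.
* PARITY CORE `pm_sum_ge`: three signs with product `1` sum to `≥ −1`; `prod3_refl`, `prod_pm_one`.
* COUNTS `cnt ℓ r = #{b ∈ {0,1}^ℓ : |b| ≡ r}`: Pascal's rule `cnt_succ`, the rotation invariant `cnt_dev`
  (`3·cnt − 2^ℓ` is a rotation of `±(2,−1,−1)`), hence `|3·cnt ℓ r − 2^ℓ| ≤ 2` (`abs_three_cnt_sub_le`); and the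
  FREE BLOCK `evo ℓ 1 u z = Σ_{z₀} u z₀ · cnt ℓ (z − z₀)` (`evo_one_eq`).

WHAT THIS IS NOT: no ring-game objects; the item itself is closed in `OddPrimeWalkSignWalkFloor.lean`.
-/

namespace Summit.QuantumAdvantage.AdviceFreeQNC0.SignWalk

open Finset

/-! ## §3 Growth bounds: sup, `ℓ¹`, squared norm; the unit contraction and its chaining -/

/-- Sup-norm growth: each step at most doubles. -/
theorem abs_evo_le (m : ℕ) (F : ℕ → ZMod 3 → ℝ) (hF : ∀ j z, |F j z| ≤ 1) (v : ZMod 3 → ℝ) (M : ℝ)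
    (hv : ∀ z, |v z| ≤ M) : ∀ z, |evo m F v z| ≤ 2 ^ m * M := by
  induction m generalizing F v M with
  | zero => intro z; simpa using hv z
  | succ m ih =>
    intro z
    rw [evo_succ, pow_succ, mul_assoc]
    refine ih _ (fun j z => hF (j + 1) z) _ (2 * M) ?_ z
    intro y
    simp only [step]
    rw [abs_mul]
    have h1 := hF 1 y
    have h2 := abs_add_le (v y) (v (y - 1))
    have h3 := hv y
    have h4 := hv (y - 1)
    have h0 : 0 ≤ |v y + v (y - 1)| := abs_nonneg _
    nlinarith

/-- `ℓ¹` growth: each step at most doubles. -/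
theorem l1_evo_le (m : ℕ) (F : ℕ → ZMod 3 → ℝ) (hF : ∀ j z, |F j z| ≤ 1) (v : ZMod 3 → ℝ) :
    ∑ z, |evo m F v z| ≤ 2 ^ m * ∑ z, |v z| := by
  induction m generalizing F v with
  | zero => simp
  | succ m ih =>
    rw [evo_succ, pow_succ, mul_assoc]
    refine (ih _ (fun j z => hF (j + 1) z) _).trans ?_
    refine mul_le_mul_of_nonneg_left ?_ (by positivity)
    have hstep : ∀ y, |step (F 1) v y| ≤ |v y| + |v (y - 1)| := by
      intro y
      simp only [step]
      rw [abs_mul]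
      have h1 := hF 1 y
      have h2 := abs_add_le (v y) (v (y - 1))
      have h0 : 0 ≤ |v y + v (y - 1)| := abs_nonneg _
      nlinarith
    have hre : ∑ y : ZMod 3, |v (y - 1)| = ∑ y, |v y| :=
      Fintype.sum_equiv (Equiv.subRight (1 : ZMod 3)) _ _ (fun _ => rfl)
    calc ∑ y, |step (F 1) v y| ≤ ∑ y, (|v y| + |v (y - 1)|) := sum_le_sum fun y _ => hstep y
      _ = 2 * ∑ y, |v y| := by rw [sum_add_distrib, hre]; ring

/-- Squared Euclidean norm on `ℝ^{ℤ₃}`. -/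
def nrm (v : ZMod 3 → ℝ) : ℝ := ∑ z, v z ^ 2

/-- The squared norm, written out. -/
theorem nrm_eq (v : ZMod 3 → ℝ) : nrm v = v 0 ^ 2 + v 1 ^ 2 + v 2 ^ 2 := sum3 _

/-- The squared norm is non-negative. -/
theorem nrm_nonneg (v : ZMod 3 → ℝ) : 0 ≤ nrm v := by rw [nrm_eq]; positivity

/-- A single coordinate is bounded by the norm. -/
theorem sq_le_nrm (v : ZMod 3 → ℝ) (z : ZMod 3) : v z ^ 2 ≤ nrm v := by
  rw [nrm_eq]
  rcases z3_cases z with rfl | rfl | rfl <;> nlinarith [sq_nonneg (v 0), sq_nonneg (v 1), sq_nonneg (v 2)]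

/-- `|x| ≤ 1 ⇒ x² ≤ 1`. -/
theorem sq_le_one_of_abs_le {x : ℝ} (h : |x| ≤ 1) : x ^ 2 ≤ 1 := by
  have := abs_le.mp h; nlinarith

/-- One step at most quadruples the squared norm (`‖P‖ ≤ 1` in normalised form). -/
theorem nrm_step_le (d v : ZMod 3 → ℝ) (hd : ∀ z, |d z| ≤ 1) : nrm (step d v) ≤ 4 * nrm v := by
  rw [nrm_eq, nrm_eq]
  simp only [step, z3_0s, z3_1s, z3_2s]
  have e0 := sq_le_one_of_abs_le (hd 0)
  have e1 := sq_le_one_of_abs_le (hd 1)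
  have e2 := sq_le_one_of_abs_le (hd 2)
  nlinarith [sq_nonneg (v 0 - v 2), sq_nonneg (v 1 - v 0), sq_nonneg (v 2 - v 1),
    mul_nonneg (sub_nonneg.mpr e0) (sq_nonneg (v 0 + v 2)),
    mul_nonneg (sub_nonneg.mpr e1) (sq_nonneg (v 1 + v 0)),
    mul_nonneg (sub_nonneg.mpr e2) (sq_nonneg (v 2 + v 1))]

/-- The reflection factor at `c`: `+1` at `c`, `−1` at the two other residues. -/
def refl (c : ZMod 3) : ZMod 3 → ℝ := fun z => if z = c then 1 else -1

/-- Value of the reflection factor. -/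
theorem refl_apply (c z : ZMod 3) : refl c z = if z = c then 1 else -1 := rfl

/-- Reflection factors are bounded by `1`. -/
theorem abs_refl_le (c z : ZMod 3) : |refl c z| ≤ 1 := by
  by_cases hz : z = c <;> simp [refl, hz]

/-- **UNIT CONTRACTION** (`‖P·diag(2δ_c − 1)·P‖² ≤ ½`, PROOF-BB L3 / `BBCore.pgp_sq_le_half`): a reflection sandwiched between
two steps costs a factor `8`, not `16`.  Three explicit sums of squares. -/
theorem nrm_step_step_le (c : ZMod 3) (d₂ v : ZMod 3 → ℝ) (hd : ∀ z, |d₂ z| ≤ 1) :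
    nrm (step d₂ (step (refl c) v)) ≤ 8 * nrm v := by
  unfold refl
  rw [nrm_eq, nrm_eq]
  have e0 := sq_le_one_of_abs_le (hd 0)
  have e1 := sq_le_one_of_abs_le (hd 1)
  have e2 := sq_le_one_of_abs_le (hd 2)
  rcases z3_cases c with rfl | rfl | rfl <;>
    simp only [step, z3_0s, z3_1s, z3_2s, z3_01, z3_02, z3_12, z3_01.symm, z3_02.symm, z3_12.symm,
      if_true, if_false]
  · nlinarith [sq_nonneg (v 0 - v 1 / 6 - v 2 / 6), sq_nonneg (v 1 - 7 * v 2 / 11), sq_nonneg (v 2),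
      mul_nonneg (sub_nonneg.mpr e0) (sq_nonneg (1 * (v 0 + v 2) + -1 * (v 2 + v 1))),
      mul_nonneg (sub_nonneg.mpr e1) (sq_nonneg (-1 * (v 1 + v 0) + 1 * (v 0 + v 2))),
      mul_nonneg (sub_nonneg.mpr e2) (sq_nonneg (-1 * (v 2 + v 1) + -1 * (v 1 + v 0)))]
  · nlinarith [sq_nonneg (v 0 - v 1 / 6 - v 2 / 6), sq_nonneg (v 1 - v 2 / 5), sq_nonneg (v 2),
      mul_nonneg (sub_nonneg.mpr e0) (sq_nonneg (-1 * (v 0 + v 2) + -1 * (v 2 + v 1))),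
      mul_nonneg (sub_nonneg.mpr e1) (sq_nonneg (1 * (v 1 + v 0) + -1 * (v 0 + v 2))),
      mul_nonneg (sub_nonneg.mpr e2) (sq_nonneg (-1 * (v 2 + v 1) + 1 * (v 1 + v 0)))]
  · nlinarith [sq_nonneg (v 0 - v 1 / 2 - v 2 / 2), sq_nonneg (v 1 - 3 * v 2 / 11), sq_nonneg (v 2),
      mul_nonneg (sub_nonneg.mpr e0) (sq_nonneg (-1 * (v 0 + v 2) + 1 * (v 2 + v 1))),
      mul_nonneg (sub_nonneg.mpr e1) (sq_nonneg (-1 * (v 1 + v 0) + -1 * (v 0 + v 2))),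
      mul_nonneg (sub_nonneg.mpr e2) (sq_nonneg (1 * (v 2 + v 1) + -1 * (v 1 + v 0)))]

/-- **CHAINED CONTRACTION.**  If `S ⊆ [1, m-1]` is a set of reflection sites no two of which are adjacent, then
`nrm (evo m F v) ≤ 4^m · 2^{-|S|} · nrm v` (every site of `S` owns the two steps around it). -/
theorem nrm_evo_le (F : ℕ → ZMod 3 → ℝ) (hF : ∀ j z, |F j z| ≤ 1) (S : Finset ℕ)
    (hrefl : ∀ c ∈ S, ∃ x, F c = refl x) (hsep : ∀ c ∈ S, c + 1 ∉ S) :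
    ∀ m, (∀ c ∈ S, 1 ≤ c ∧ c + 1 ≤ m) → ∀ v, nrm (evo m F v) ≤ 4 ^ m * (1 / 2) ^ S.card * nrm v := by
  intro m
  induction m using Nat.strong_induction_on generalizing S with
  | _ m ih =>
    intro hS v
    rcases m with _ | m
    · -- no sites at all
      have hS0 : S = ∅ := by
        rw [Finset.eq_empty_iff_forall_notMem]
        intro c hc; have := hS c hc; omega
      subst hS0; simp
    by_cases hm : m ∈ S
    · -- unit centred at site `m`: steps `m` and `m + 1`
      obtain ⟨m', rfl⟩ : ∃ m', m = m' + 1 := ⟨m - 1, by have := (hS _ hm).1; omega⟩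
      rw [evo_last, evo_last]
      have hS' : ∀ c ∈ S.erase (m' + 1), 1 ≤ c ∧ c + 1 ≤ m' := by
        intro c hc
        rw [Finset.mem_erase] at hc
        refine ⟨(hS c hc.2).1, ?_⟩
        have h2 := (hS c hc.2).2
        rcases Nat.lt_or_ge c m' with h | h
        · omega
        · exfalso
          have hc' : c = m' := by omega
          subst hc'
          exact hsep c hc.2 hm
      have hih := ih m' (by omega) (S.erase (m' + 1)) (fun c hc => hrefl c (Finset.mem_of_mem_erase hc))
        (fun c hc h' => hsep c (Finset.mem_of_mem_erase hc) (Finset.mem_of_mem_erase h')) hS' v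
      obtain ⟨x, hx⟩ := hrefl _ hm
      have hunit := nrm_step_step_le x (F (m' + 1 + 1)) (evo m' F v) (hF _)
      rw [← hx] at hunit
      rw [Finset.card_erase_of_mem hm] at hih
      have hcard : 1 ≤ S.card := Finset.card_pos.mpr ⟨_, hm⟩
      have hpow : (1 / 2 : ℝ) ^ (S.card - 1) = 2 * (1 / 2) ^ S.card := by
        obtain ⟨t, ht⟩ : ∃ t, S.card = t + 1 := ⟨S.card - 1, by omega⟩
        rw [ht, Nat.add_sub_cancel, pow_succ]; ring
      rw [hpow] at hih
      have h0 : (0 : ℝ) ≤ 4 ^ m' * (1 / 2) ^ S.card * nrm v := by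
        have := nrm_nonneg v; positivity
      calc nrm (step (F (m' + 1 + 1)) (step (F (m' + 1)) (evo m' F v)))
          ≤ 8 * nrm (evo m' F v) := hunit
        _ ≤ 8 * (4 ^ m' * (2 * (1 / 2) ^ S.card) * nrm v) := by nlinarith
        _ = 4 ^ (m' + 1 + 1) * (1 / 2) ^ S.card * nrm v := by ring
    · -- plain step at site `m + 1`
      rw [evo_last]
      have hS' : ∀ c ∈ S, 1 ≤ c ∧ c + 1 ≤ m := by
        intro c hc
        refine ⟨(hS c hc).1, ?_⟩
        have h2 := (hS c hc).2
        rcases Nat.lt_or_ge (c + 1) (m + 1) with h | h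
        · omega
        · exfalso; apply hm
          have hc' : c = m := by omega
          rw [← hc']; exact hc
      have hih := ih m (by omega) S hrefl hsep hS' v
      have hstep := nrm_step_le (F (m + 1)) (evo m F v) (hF _)
      have h0 : (0 : ℝ) ≤ 4 ^ m * (1 / 2) ^ S.card * nrm v := by
        have := nrm_nonneg v; positivity
      calc nrm (step (F (m + 1)) (evo m F v)) ≤ 4 * nrm (evo m F v) := hstep
        _ ≤ 4 * (4 ^ m * (1 / 2) ^ S.card * nrm v) := by nlinarith
        _ = 4 ^ (m + 1) * (1 / 2) ^ S.card * nrm v := by ring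

/-! ## §4 Parity core -/

/-- Three signs with product `1` are `(1,1,1)` or a permutation of `(1,−1,−1)`: their sum is `≥ −1`. -/
theorem pm_sum_ge (P : ZMod 3 → ℝ) (h1 : ∀ w, P w = 1 ∨ P w = -1) (h2 : ∏ w, P w = 1) :
    -1 ≤ ∑ w, P w := by
  rw [prod3] at h2
  rw [sum3]
  rcases h1 0 with h0 | h0 <;> rcases h1 1 with h1' | h1' <;> rcases h1 2 with h2' | h2' <;>
    rw [h0, h1', h2'] at h2 ⊢ <;> norm_num at h2 <;> norm_num

/-- A reflection takes the value `+1` once and `−1` twice: product `1`. -/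
theorem prod3_refl (c : ZMod 3) : ∏ w : ZMod 3, (if w = c then (1 : ℝ) else -1) = 1 := by
  rw [prod3]
  rcases z3_cases c with rfl | rfl | rfl <;> simp [z3_02, z3_12, z3_01.symm, z3_02.symm, z3_12.symm]

/-- A product of `±1`'s is `±1`. -/
theorem prod_pm_one {ι : Type*} (s : Finset ι) (f : ι → ℝ) (hf : ∀ i ∈ s, f i = 1 ∨ f i = -1) :
    ∏ i ∈ s, f i = 1 ∨ ∏ i ∈ s, f i = -1 := by
  classical
  induction s using Finset.induction_on with
  | empty => simp
  | insert a s ha ih =>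
    rw [Finset.prod_insert ha]
    rcases hf a (Finset.mem_insert_self a s) with h | h <;>
      rcases ih (fun i hi => hf i (Finset.mem_insert_of_mem hi)) with h' | h' <;>
      simp [h, h']

/-! ## §5 Counts of `{0,1}^ℓ` by weight mod 3 and the free block -/

/-- `cnt ℓ r = #{b ∈ {0,1}^ℓ : |b| ≡ r (mod 3)}` (as a real number). -/
def cnt (ℓ : ℕ) (r : ZMod 3) : ℝ := ((univ.filter fun b : Fin ℓ → Bool => wtZ ℓ b = r).card : ℝ)

/-- **Free block**: `ℓ` steps with trivial site factors convolve with the counts. -/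
theorem evo_one_eq (ℓ : ℕ) (u : ZMod 3 → ℝ) (z : ZMod 3) :
    evo ℓ (fun _ _ => 1) u z = ∑ z₀, u z₀ * cnt ℓ (z - z₀) := by
  rw [evo_eq_pathsum]
  unfold pathsum cnt
  rw [sum_comm]
  refine sum_congr rfl fun z₀ _ => ?_
  simp only [prod_const_one, mul_one]
  rw [Finset.card_filter, Nat.cast_sum, mul_sum]
  refine sum_congr rfl fun b _ => ?_
  by_cases h : z₀ + wtZ ℓ b = z
  · have h' : wtZ ℓ b = z - z₀ := by rw [← h]; ring
    simp [h']
  · have h' : ¬ wtZ ℓ b = z - z₀ := by intro h'; apply h; rw [h']; ring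
    simp [h, h']

/-- The counts as an evolution of `δ₀`. -/
theorem cnt_eq_evo (ℓ : ℕ) (r : ZMod 3) :
    cnt ℓ r = evo ℓ (fun _ _ => 1) (fun z => if z = 0 then 1 else 0) r := by
  rw [evo_one_eq, sum_eq_single (0 : ZMod 3)]
  · simp
  · intro z₀ _ h; simp [h]
  · simp

/-- Pascal's rule mod 3: `cnt (ℓ+1) r = cnt ℓ r + cnt ℓ (r − 1)`. -/
theorem cnt_succ (ℓ : ℕ) (r : ZMod 3) : cnt (ℓ + 1) r = cnt ℓ r + cnt ℓ (r - 1) := by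
  rw [cnt_eq_evo, evo_last, cnt_eq_evo, cnt_eq_evo]
  simp [step]

/-- `cnt 0 = δ₀`. -/
theorem cnt_zero (r : ZMod 3) : cnt 0 r = if r = 0 then 1 else 0 := by
  rw [cnt_eq_evo, evo_zero]

/-- One Pascal step maps the pattern `(2,−1,−1)` centred at `z₀` to its negative centred at `z₀ − 1`. -/
theorem rot_step (z₀ r : ZMod 3) :
    ((if r = z₀ then (2 : ℝ) else -1) + (if r - 1 = z₀ then 2 else -1)) = -(if r = z₀ - 1 then 2 else -1) := by
  rcases z3_cases z₀ with rfl | rfl | rfl <;> rcases z3_cases r with rfl | rfl | rfl <;>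
    simp only [z3_0s, z3_1s, z3_2s, z3_01, z3_02, z3_12, z3_01.symm, z3_02.symm, z3_12.symm, if_true,
      if_false] <;>
    norm_num

/-- The deviation vector `3·cnt ℓ − 2^ℓ` is always a rotation of `±(2, −1, −1)`. -/
theorem cnt_dev (ℓ : ℕ) : ∃ s : ℝ, (s = 1 ∨ s = -1) ∧ ∃ z₀ : ZMod 3, ∀ r,
    3 * cnt ℓ r - 2 ^ ℓ = s * (if r = z₀ then 2 else -1) := by
  induction ℓ with
  | zero =>
    refine ⟨1, Or.inl rfl, 0, fun r => ?_⟩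
    rw [cnt_zero]
    by_cases h : r = 0
    · simp [h]; norm_num
    · simp [h]
  | succ ℓ ih =>
    obtain ⟨s, hs, z₀, h⟩ := ih
    refine ⟨-s, by rcases hs with rfl | rfl <;> norm_num, z₀ - 1, fun r => ?_⟩
    have e : 3 * cnt (ℓ + 1) r - 2 ^ (ℓ + 1) = (3 * cnt ℓ r - 2 ^ ℓ) + (3 * cnt ℓ (r - 1) - 2 ^ ℓ) := by
      rw [cnt_succ]; ring
    rw [e, h r, h (r - 1), ← mul_add, rot_step z₀ r]
    ring

/-- `|3·cnt ℓ r − 2^ℓ| ≤ 2`: every weight class mod 3 of `{0,1}^ℓ` has `2^ℓ/3 ± 2/3` elements. -/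
theorem abs_three_cnt_sub_le (ℓ : ℕ) (r : ZMod 3) : |3 * cnt ℓ r - 2 ^ ℓ| ≤ 2 := by
  obtain ⟨s, hs, z₀, h⟩ := cnt_dev ℓ
  rw [h r, abs_le]
  rcases hs with rfl | rfl <;> by_cases hr : r = z₀ <;> simp [hr] <;> norm_num

end Summit.QuantumAdvantage.AdviceFreeQNC0.SignWalk
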